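import Summits.ResolutionOfSingularities.ResolutionOfSingularities.Theses.Descent
import Summits.ResolutionOfSingularities.ResolutionOfSingularities.Theorems.DescentDescentPerfectToAllFgModel
import Summits.ResolutionOfSingularities.ResolutionOfSingularities.Theorems.DescentDescentPerfectToAllLevelResolution
import Summits.ResolutionOfSingularities.ResolutionOfSingularities.Theorems.DescentDescentPerfectToAllRobustSeparable
import Summits.ResolutionOfSingularities.ResolutionOfSingularities.Theorems.DescentDescentPerfectToAllFiniteLevels
import Summits.ResolutionOfSingularities.ResolutionOfSingularities.Theorems.DescentDescentPerfectToAllRobustModel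

/-!
# `DescentPerfectToAll` (stmt-ResolutionOfSingularities-0549): reduction to the MacLane-obstructed residual,
# and the separable case of the crux

Route `ResolutionOfSingularities/Descent` (crux shared verbatim with `WeightedInvariant` and
`UniformComplexity`), line `arc-special-fibre-transversality` of the lead
prover-line-stmt-ResolutionOfSingularities-0549-0. Six of the seven registered stubs of the lead skeleton are
theorems of the tree (`stub_fgModel`, `stub_levelResolution`, `stub_robustLevelSeparable`,
`stub_regularOfFiniteLevels`, `stub_resolutionOfRobustModel`, `stub_propagation`). This file records, sorry-free,
what they buy:

* `descentPerfectToAll_of_robustLevelInseparable` — **the crux follows from its MacLane-obstructed residual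
  alone**: if, for every field `k` of characteristic `p` admitting resolutions over all its finitely generated
  subfields, every reduced `X₀ ×_{K₀} k` (`K₀` finitely generated) above which `k` is separable over NO finitely
  generated level still has a robust finite-level model, then `DescentPerfectToAll` holds. The hypothesis is the
  verbatim statement of the one open stub `stub_robustLevelInseparable` (summit-implied; Temkin 2008,
  Question 3.3.3; it is the `𝔽_p((t))`, `trdeg K₀ ≥ 2` case — MacLane).
* `hasResolution_of_perfectRes_of_separablyExhausted` — **the separable case of the crux, unconditionally**:
  resolution over all perfect fields of characteristic `p` implies resolution of every reduced separated scheme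
  of finite type over every field `k` of characteristic `p` that is separably exhausted by finitely generated
  subfields (every finite subset lies in a finitely generated `L` with `k/L` separable in MacLane's sense) — e.g.
  `k` finitely generated, or purely transcendental over `𝔽_p` of any transcendence degree (Cossart–Piltant 2009
  work under differential finiteness precisely to stay inside this case); `𝔽_p((t))` is not covered.

Both are compositions of the landed stubs; no new mathematics is claimed here.
-/

noncomputable section

set_option linter.dupNamespace false -- mandated namespace of this single-conjunct summit

open CategoryTheory CategoryTheory.Limits AlgebraicGeometry
open Literature.AlgebraicGeometry.Resolution

namespace Summit.ResolutionOfSingularities.ResolutionOfSingularities.Theorems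

/-- **Reduction of the crux to its residual.** `DescentPerfectToAll` (perfect ⇒ all fields of characteristic
`p`) follows from the MacLane-obstructed case of a robust finite-level model — the hypothesis is verbatim the open
stub `stub_robustLevelInseparable` of the line `arc-special-fibre-transversality`; everything else (spreading out,
resolution over finitely generated fields from the antecedent, the separable case, regularity of the limit, base
change of the robust model) is proved in the tree. [folklore] -/
theorem descentPerfectToAll_of_robustLevelInseparable : (∀ (p : ℕ) [Fact p.Prime] (k : Type) [Field k] [CharP k p], (∀ (L : Subfield k) (t : Finset k), L = Subfield.closure (↑t : Set k) → ∀ (Z : Scheme.{0}) (g : Z ⟶ Spec (.of L)), IsSeparated g → LocallyOfFiniteType g → QuasiCompact g → IsReduced Z → Scheme.HasResolution Z) → ∀ (K₀ : Subfield k) (s : Finset k), K₀ = Subfield.closure (↑s : Set k) → ∀ (X₀ : Scheme.{0}) (f₀ : X₀ ⟶ Spec (.of K₀)), IsSeparated f₀ → LocallyOfFiniteType f₀ → QuasiCompact f₀ → IsReduced X₀ → IsReduced (pullback f₀ (Spec.map (CommRingCat.ofHom K₀.subtype))) → (¬ ∃ (L : Subfield k) (_ : K₀ ≤ L) (t : Finset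 k), L = Subfield.closure (↑t : Set k) ∧ ∀ u : Finset k, LinearIndepOn L _root_.id (↑u : Set k) → LinearIndepOn L (fun x : k => x ^ p) (↑u : Set k)) → ∃ (L : Subfield k) (hL : K₀ ≤ L) (t : Finset k), L = Subfield.closure (↑t : Set k) ∧ ∃ (Y : Scheme.{0}) (π : Y ⟶ pullback f₀ (Spec.map (CommRingCat.ofHom (Subfield.inclusion hL)))), IsProper π ∧ IsBirational π ∧ ∀ (L' : Subfield k) (hL' : L ≤ L') (t' : Finset k), L' = Subfield.closure (↑t' : Set k) → ∃ (Ω : Type) (_ : Field Ω) (φ : L' →+* Ω), Scheme.IsRegular (pullback (π ≫ pullback.snd f₀ (Spec.map (CommRingCat.ofHom (Subfield.inclusion hL)))) (Spec.map (CommRingCat.ofHom (φ.comp (Subfield.inclusion hL')))))) → Summit.ResolutionOfSingularities.ResolutionOfSingularities.Theses.Descent.DescentPerfectToAll := by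
  intro hcore p hp H k _ _ X f hsep hlft hqc hred
  haveI : Fact p.Prime := ⟨hp⟩
  -- 1. finitely generated field of definition
  obtain ⟨K₀, s, hK₀, X₀, f₀, h₁, h₂, h₃, h₄, ⟨e⟩⟩ := stub_fgModel k X f hsep hlft hqc hred
  haveI := hred
  have hredb : IsReduced (pullback f₀ (Spec.map (CommRingCat.ofHom K₀.subtype))) :=
    isReduced_of_isOpenImmersion e.inv
  -- 2a. the antecedent: resolutions at every finitely generated level
  have hlev := stub_levelResolution p (fun κ _ _ _ Z h a b c d => H κ Z h a b c d) k
  -- 2b. a robust level, by cases on MacLane separability over the finitely generated levels above `K₀`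
  obtain ⟨L, hL, t, hLt, Y, π, hπp, hπb, hrob⟩ : ∃ (L : Subfield k) (hL : K₀ ≤ L) (t : Finset k),
      L = Subfield.closure (↑t : Set k) ∧ ∃ (Y : Scheme.{0})
        (π : Y ⟶ pullback f₀ (Spec.map (CommRingCat.ofHom (Subfield.inclusion hL)))),
        IsProper π ∧ IsBirational π ∧ ∀ (L' : Subfield k) (hL' : L ≤ L') (t' : Finset k),
          L' = Subfield.closure (↑t' : Set k) → ∃ (Ω : Type) (_ : Field Ω) (φ : L' →+* Ω),
            Scheme.IsRegular (pullback (π ≫ pullback.snd f₀ (Spec.map (CommRingCat.ofHom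
              (Subfield.inclusion hL)))) (Spec.map (CommRingCat.ofHom (φ.comp (Subfield.inclusion hL'))))) := by
    by_cases hs : ∃ (L : Subfield k) (_ : K₀ ≤ L) (t : Finset k), L = Subfield.closure (↑t : Set k) ∧
        ∀ u : Finset k, LinearIndepOn L _root_.id (↑u : Set k) → LinearIndepOn L (fun x : k => x ^ p) (↑u : Set k)
    · exact stub_robustLevelSeparable p k hlev K₀ s hK₀ X₀ f₀ h₁ h₂ h₃ h₄ hredb hs
    · exact hcore p k hlev K₀ s hK₀ X₀ f₀ h₁ h₂ h₃ h₄ hredb hs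
  haveI := h₁; haveI := h₂; haveI := h₃; haveI := hπp
  -- 3. regularity of `Y ×_L k` from the finite levels
  have hreg : Scheme.IsRegular (pullback (π ≫ pullback.snd f₀ (Spec.map (CommRingCat.ofHom
      (Subfield.inclusion hL)))) (Spec.map (CommRingCat.ofHom L.subtype))) :=
    stub_regularOfFiniteLevels k L t hLt Y _ inferInstance inferInstance hrob
  -- 4. base change of the robust model resolves `X₀ ×_{K₀} k ≅ X`
  exact (stub_resolutionOfRobustModel k K₀ L hL X₀ f₀ h₁ h₂ h₃ Y π hπp hπb hreg).of_iso e.inv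

/-- **The separable case of the crux, unconditionally (Disproof §6 `PerfectToSeparableOverModel`).** If every
reduced separated scheme of finite type over every perfect field of characteristic `p` has a resolution, then so
does every reduced separated scheme of finite type over a field `k` of characteristic `p` which is
*separably exhausted by finitely generated subfields*: every finite subset of `k` lies in a finitely generated
subfield `L = closure t` over which `k` is separable in MacLane's sense (`L`-linearly independent finite families
of `k` have `L`-linearly independent `p`-th powers). Examples: `k` finitely generated; `k` purely transcendental
over `𝔽_p` of any transcendence degree; `k` separable over a finitely generated field of definition of `X`.
Not an example: `𝔽_p((t))` (p-rank 1). [cite: EGAIV2, Prop. 6.7.4] -/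
theorem hasResolution_of_perfectRes_of_separablyExhausted : ∀ (p : ℕ) [Fact p.Prime], (∀ (κ : Type) [Field κ] [CharP κ p] [PerfectField κ] (Z : Scheme.{0}) (h : Z ⟶ Spec (.of κ)), IsSeparated h → LocallyOfFiniteType h → QuasiCompact h → IsReduced Z → Scheme.HasResolution Z) → ∀ (k : Type) [Field k] [CharP k p], (∀ s : Finset k, ∃ (L : Subfield k) (t : Finset k), L = Subfield.closure (↑t : Set k) ∧ (↑s : Set k) ⊆ L ∧ ∀ u : Finset k, LinearIndepOn L _root_.id (↑u : Set k) → LinearIndepOn L (fun x : k => x ^ p) (↑u : Set k)) → ∀ (X : Scheme.{0}) (f : X ⟶ Spec (.of k)), IsSeparated f → LocallyOfFiniteType f → QuasiCompact f → IsReduced X → Scheme.HasResolution X := by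
  intro p _ H k _ _ hsep X f _ _ _ _
  -- finitely generated field of definition
  obtain ⟨K₀, s, hK₀, X₀, f₀, h₁, h₂, h₃, h₄, ⟨e⟩⟩ := stub_fgModel k X f ‹_› ‹_› ‹_› ‹_›
  have hredb : IsReduced (pullback f₀ (Spec.map (CommRingCat.ofHom K₀.subtype))) :=
    isReduced_of_isOpenImmersion e.inv
  -- a separable finitely generated level above it
  obtain ⟨L, t, hLt, hsL, hML⟩ := hsep s
  have hL : K₀ ≤ L := by
    rw [hK₀]
    exact Subfield.closure_le.mpr hsL
  have hlev := stub_levelResolution p (fun κ _ _ _ Z h a b c d => H κ Z h a b c d) k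
  obtain ⟨L₁, hL₁, t₁, hLt₁, Y, π, hπp, hπb, hrob⟩ :=
    stub_robustLevelSeparable p k hlev K₀ s hK₀ X₀ f₀ h₁ h₂ h₃ h₄ hredb ⟨L, hL, t, hLt, hML⟩
  haveI := h₁; haveI := h₂; haveI := h₃; haveI := hπp
  have hreg : Scheme.IsRegular (pullback (π ≫ pullback.snd f₀ (Spec.map (CommRingCat.ofHom
      (Subfield.inclusion hL₁)))) (Spec.map (CommRingCat.ofHom L₁.subtype))) :=
    stub_regularOfFiniteLevels k L₁ t₁ hLt₁ Y _ inferInstance inferInstance hrob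
  exact (stub_resolutionOfRobustModel k K₀ L₁ hL₁ X₀ f₀ h₁ h₂ h₃ Y π hπp hπb hreg).of_iso e.inv

end Summit.ResolutionOfSingularities.ResolutionOfSingularities.Theorems

end
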